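/-
Copyright (c) 2026 the pub-hodgecm-mathlib formalisation cell (harness21).  Prover seat hodgecm-mathlib-F0P3a-p02 (g16): road «S3-ram» (LEAD F0P3a-plan (g12); architect
A-p16 (g31) 23:04:38Z deal (4) «(a2)(C-fin) CONIC CHARACTER SUM», scope (iii) only per ref5 (g4) R-273 and F0P3a-p01 (g16) 23:06:35Z), organ A′ (ii) (a2) part (C-fin)(iii), FILE B; 2026-09-01.
-/
import Literature.NumberTheory.Rogawski1990.DepthZeroKappaTransferTypeOneRamifiedRootClassSum      -- FILE A (this seat): `sum_ite_iso_elim_mid`, `sum_quadraticChar_binaryForm`, `rootClassSum_twist`, `signedSum_rootClassSum_twists`; ⊇ ★ p847132 `card_rootNull`, `signedSum_card_rootNull_twists`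
import HarnessLib

/-!
# The depth-zero κ-transfer at a tame-ramified place, type (1): the ROOT CLASS SPLIT — the κ-signed `1⁺` and `1⁻` top-layer slots are EQUAL,
# `Σ_b κ_b·#{class σ}_b = −2(q−1)·χ(−u₀u₂AC)` in vector currency (organ A′ (ii)(a2), part (C-fin)(iii), FILE B — the counts)

Topic `NumberTheory/Rogawski1990`; namespace `Literature.NumberTheory.Rogawski1990`.  THEOREMS ONLY (no definition, no instance, no notation, no named fact, no `sorry`);
kernel lane `--supports stmt-HodgeConjecture-24833`.  Cell `pub/hodgecm-mathlib`, crux H413; road «S3-ram» (Literature seeding, count-neutral), P-1-ram skeleton organ A′ (ii)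
(architect A-p16 (g31) deal (4) 2026-09-01T23:04:38Z), deal (a2) part (C).  FILE B of two: over FILE A (`…RootClassSum`: `J_c` twist-invariant) and ★ p847132 (F0P3a-p01 (g16):
`card_rootNull`, `signedSum_card_rootNull_twists`, `sum_card_rootNull_twists`) — the NON-null isotropic vectors split by the SQUARE CLASS of the root's leading form, i.e. the
`1⁺ ∕ 1⁻` (= `P^{±}_{k−1}`) slots of the κ-summed top layer (F0P3a-p01's design memo `DESIGN-a2C-RootBookkeeping.v1` bc8b04ba §4 (C2)∕(C3); his numerics `rootsums∕pairs∕jinv.py`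
and this seat's agree for q ≤ 13).  HONEST LABEL: HC_CM is proved only modulo the 2 remaining named inputs (hLiu418 24832, h413 24833) until rung 0 closes; finite-field algebra only.

THE MATHEMATICS (notation of FILE A: literal `d = (d₀,d₁,d₂)`, `Q_d(v) = d₀A·v_α² + d₂C·v_γ²`, class `χ(c·Q_d(v))`, `J_c(d) = Σ_{v iso} χ(cQ_d(v))`, vectors `v ∈ k × k × k`).
(§2) `#{v : iso} = q²` (eliminate `v_u`; ★ FILE A `sum_quadraticChar_binaryForm`); the NULL vectors `#{v : iso ∧ Q = 0} = 1 + (q−1)·#{F0P3a-p01's chart-null points}` (eliminate `v_u`: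
on `Q = 0`, `−d₁(d₀x² + d₂z²) = d₀d₁C(A−C)·(x∕C)²`; ★ `card_rootNull`'s closed form); `J_c = #{class +} − #{class −}`; the partition `#{iso} = #{+} + #{−} + #{iso ∧ Q = 0}`; hence
`2·#{class σ}_d = q² − #{iso ∧ Q = 0}_d + σ·J_c(d)` (`σ = ±1`).  (§3) Summing with `κ_b = (−1)^{b_u}` over the four twists `d^{(b)} = (ε^{b_α}u₀, ε^{b_u}u₁, ε^{b_α+b_u}u₂)`
(★ `signedSum_card_rootNull_twists` for the null part, ★ FILE A `signedSum_rootClassSum_twists` for `J`):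
  **`Σ_b κ_b · #{v ∈ k³ : iso_b(v) ∧ χ(c·Q_b(v)) = σ} = −2(q − 1)·χ(−u₀u₂AC)`  for BOTH `σ = 1` and `σ = −1`, EVERY `c ≠ 0`**
— the κ-signed non-null top layer `−4(q−1)χ(−u₀u₂AC)` splits EVENLY between the two classes (certificate: `X̃_{1⁺} = X̃_{1⁻}`), while the UNSIGNED split is
`2·Σ_b #{class σ}_b = 4q(q−1) + 4σ·J_c(u)` (★ `sum_card_rootNull_twists`), governed by the single twist-invariant sum `J_c(u)`.  In LINE currency divide by `q − 1` (all statements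
are homogeneous in `v`).

* §2 `card_iso_eq_sq` (`#{iso} = q²`), `card_isoNull_eq` (null vectors `= 1 + (q−1)·`chart count), `rootClassSum_eq_card_sub_card` (`J = #{+} − #{−}`),
  `card_iso_eq_card_add_card_add_card` (partition), `two_mul_card_rootClass_eq` (`2#{class σ} = q² − #null + σJ`).
* §3 **`signedSum_card_rootClass_twists`** (THE κ-SIGNED CLASS COUNT), `two_mul_sum_card_rootClass_twists` (the unsigned one through `J`).

## References
* [Rogawski1990] J. D. Rogawski, *Automorphic Representations of Unitary Groups in Three Variables*, Ann. of Math. Stud. 123 (1990), §4.9 Prop. 4.9.1 (a)(b) p. 55; §12.2.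
* [LabesseLanglands1979] J.-P. Labesse, R. P. Langlands, *L-indistinguishability for SL(2)*, Canad. J. Math. 31 (1979), §5 (κ-signs over the four classes).
* [IrelandRosen1990] K. Ireland, M. Rosen, *A Classical Introduction to Modern Number Theory*, GTM 84, Ch. 8 §1–§2 (quadratic character sums).
-/

set_option autoImplicit false

namespace Literature.NumberTheory.Rogawski1990

open Finset

variable {k : Type*} [Field k] [Fintype k] [DecidableEq k]

/-! ## §2 Counts: all isotropic vectors, null vectors, and the two classes -/

section Counts

variable {d₀ d₁ d₂ A C c : k}

/-- **`#{v ∈ k³ : Σ dᵢvᵢ² = 0} = q²`** (including `v = 0`; eliminate `x_u`, the character part vanishes by ★ `sum_quadraticChar_binaryForm`). [cite: IrelandRosen1990, Ch. 8 §2] -/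
theorem card_iso_eq_sq (hk : ringChar k ≠ 2) (hd₀ : d₀ ≠ 0) (hd₁ : d₁ ≠ 0) (hd₂ : d₂ ≠ 0) :
    ((univ.filter fun v : k × k × k => d₀ * v.1 ^ 2 + d₁ * v.2.1 ^ 2 + d₂ * v.2.2 ^ 2 = 0).card : ℤ) = (Fintype.card k : ℤ) ^ 2 := by
  rw [natCast_card_filter, sum_ite_iso_elim_mid hk hd₁ (fun _ _ => (1 : ℤ))]
  simp_rw [mul_one, Finset.sum_add_distrib]
  have h0 : ∑ p : k × k, quadraticChar k (-(d₁ * (d₀ * p.1 ^ 2 + d₂ * p.2 ^ 2))) = 0 := by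
    have h := sum_quadraticChar_binaryForm hk (neg_ne_zero.2 (mul_ne_zero hd₁ hd₀)) (neg_ne_zero.2 (mul_ne_zero hd₁ hd₂))
    rw [← h]
    exact Finset.sum_congr rfl fun p _ => by congr 1; ring
  rw [h0, zero_add, Finset.sum_const, Finset.card_univ, Fintype.card_prod, nsmul_eq_mul, mul_one, Nat.cast_mul, sq]

/-- **THE NULL VECTORS: `#{v ∈ k³ : iso ∧ Q(v) = 0} = 1 + (q − 1)·#{chart null points}`** — the zero vector plus `q − 1` multiples of each of F0P3a-p01's null points in the chart
`x_α = 1` (★ `card_rootNull`; eliminate `x_u`: on `Q = 0`, `−d₁(d₀x² + d₂z²) = d₀d₁C(A−C)·(x∕C)²`). [cite: Rogawski1990, §4.9 Prop. 4.9.1 (b) p. 55] [cite: IrelandRosen1990, Ch. 8 §2] -/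
theorem card_isoNull_eq (hk : ringChar k ≠ 2) (hd₁ : d₁ ≠ 0) (hd₂ : d₂ ≠ 0) (hC : C ≠ 0) :
    ((univ.filter fun v : k × k × k => d₀ * v.1 ^ 2 + d₁ * v.2.1 ^ 2 + d₂ * v.2.2 ^ 2 = 0 ∧ d₀ * A * v.1 ^ 2 + d₂ * C * v.2.2 ^ 2 = 0).card : ℤ) =
      1 + ((Fintype.card k : ℤ) - 1) *
        ((univ.filter fun p : k × k => d₀ + d₁ * p.1 ^ 2 + d₂ * p.2 ^ 2 = 0 ∧ d₀ * A + d₂ * C * p.2 ^ 2 = 0).card : ℤ) := by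
  rw [card_rootNull hk hd₁ hd₂ hC, natCast_card_filter]
  simp_rw [ite_and]
  rw [sum_ite_iso_elim_mid hk hd₁ (fun x z => if d₀ * A * x ^ 2 + d₂ * C * z ^ 2 = 0 then (1 : ℤ) else 0), Fintype.sum_prod_type]
  -- on `Q(x,z) = 0`: `χ(−d₁(d₀x² + d₂z²)) = χ(d₀d₁C(A−C))·χ(x∕C)²`
  have hx : ∀ x : k, ∑ z : k, (quadraticChar k (-(d₁ * (d₀ * x ^ 2 + d₂ * z ^ 2))) + 1) * (if d₀ * A * x ^ 2 + d₂ * C * z ^ 2 = 0 then (1 : ℤ) else 0) =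
      (quadraticChar k (d₀ * d₁ * C * (A - C)) * quadraticChar k (x / C) ^ 2 + 1) * (quadraticChar k (-(d₀ * d₂ * A * C) * x ^ 2) + 1) := by
    intro x
    simp_rw [mul_ite, mul_one, mul_zero]
    rw [← Finset.sum_filter]
    have hcongr : ∀ z ∈ univ.filter (fun z : k => d₀ * A * x ^ 2 + d₂ * C * z ^ 2 = 0),
        quadraticChar k (-(d₁ * (d₀ * x ^ 2 + d₂ * z ^ 2))) + 1 = quadraticChar k (d₀ * d₁ * C * (A - C)) * quadraticChar k (x / C) ^ 2 + 1 := by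
      intro z hz
      rw [mem_filter] at hz
      have h : -(d₁ * (d₀ * x ^ 2 + d₂ * z ^ 2)) = d₀ * d₁ * C * (A - C) * (x / C) ^ 2 := by
        rw [div_pow, ← mul_div_assoc, eq_div_iff (pow_ne_zero 2 hC)]
        linear_combination (-(d₁ * C)) * hz.2
      have h' : quadraticChar k (d₀ * d₁ * C * (A - C) * (x / C) ^ 2) = quadraticChar k (d₀ * d₁ * C * (A - C)) * quadraticChar k (x / C) ^ 2 := by
        rw [map_mul, map_pow]
      rw [h, h']
    rw [Finset.sum_congr rfl hcongr, Finset.sum_const, nsmul_eq_mul, mul_comm]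
    congr 1
    have hiff : ∀ z : k, d₀ * A * x ^ 2 + d₂ * C * z ^ 2 = 0 ↔ (d₂ * C * z) ^ 2 = -(d₀ * d₂ * A * C) * x ^ 2 := by
      intro z
      constructor
      · intro h
        linear_combination (d₂ * C) * h
      · intro h
        have h' : (d₂ * C) * (d₀ * A * x ^ 2 + d₂ * C * z ^ 2) = 0 := by linear_combination h
        rcases mul_eq_zero.1 h' with h1 | h1
        · exact absurd h1 (mul_ne_zero hd₂ hC)
        · exact h1
    simp_rw [hiff]
    exact card_filter_mul_sq_eq hk (mul_ne_zero hd₂ hC) _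
  simp_rw [hx]
  -- split `x = 0` ∕ `x ≠ 0`
  rw [Fintype.sum_eq_add_sum_compl (0 : k)]
  simp only [zero_div, MulChar.map_zero, zero_pow two_ne_zero, mul_zero, zero_add, one_mul]
  have hrest : ∀ x ∈ ({(0 : k)}ᶜ : Finset k), (quadraticChar k (d₀ * d₁ * C * (A - C)) * quadraticChar k (x / C) ^ 2 + 1) *
      (quadraticChar k (-(d₀ * d₂ * A * C) * x ^ 2) + 1) =
      (quadraticChar k (d₀ * d₁ * C * (A - C)) + 1) * (quadraticChar k (-(d₀ * d₂ * A * C)) + 1) := by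
    intro x hx
    rw [Finset.mem_compl, Finset.mem_singleton] at hx
    have e2 : quadraticChar k (-(d₀ * d₂ * A * C) * x ^ 2) = quadraticChar k (-(d₀ * d₂ * A * C)) := by
      rw [map_mul, map_pow, quadraticChar_sq_one hx, mul_one]
    rw [quadraticChar_sq_one (div_ne_zero hx hC), mul_one, e2]
  rw [Finset.sum_congr rfl hrest, Finset.sum_const, Finset.card_compl, Finset.card_singleton, nsmul_eq_mul,
    Nat.cast_sub Fintype.card_pos, Nat.cast_one]

/-- `χ(t)` as a difference of class indicators: `χ t = [χ t = 1] − [χ t = −1]`. [cite: IrelandRosen1990, Ch. 8 §1] -/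
private theorem quadraticChar_eq_ite_sub_ite (t : k) :
    quadraticChar k t = (if quadraticChar k t = 1 then (1 : ℤ) else 0) - (if quadraticChar k t = -1 then (1 : ℤ) else 0) := by
  rcases eq_or_ne t 0 with rfl | ht
  · rw [MulChar.map_zero]; norm_num
  · rcases quadraticChar_dichotomy ht with h | h <;> rw [h] <;> norm_num

/-- **`J_c(d) = #{class +} − #{class −}`** (vector currency; the zero vector and the null vectors contribute `0`). [cite: Rogawski1990, §4.9 Prop. 4.9.1 (b) p. 55] -/
theorem rootClassSum_eq_card_sub_card :
    (∑ v : k × k × k, if d₀ * v.1 ^ 2 + d₁ * v.2.1 ^ 2 + d₂ * v.2.2 ^ 2 = 0 then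
        quadraticChar k (c * (d₀ * A * v.1 ^ 2 + d₂ * C * v.2.2 ^ 2)) else 0) =
      ((univ.filter fun v : k × k × k => d₀ * v.1 ^ 2 + d₁ * v.2.1 ^ 2 + d₂ * v.2.2 ^ 2 = 0 ∧
          quadraticChar k (c * (d₀ * A * v.1 ^ 2 + d₂ * C * v.2.2 ^ 2)) = 1).card : ℤ) -
      ((univ.filter fun v : k × k × k => d₀ * v.1 ^ 2 + d₁ * v.2.1 ^ 2 + d₂ * v.2.2 ^ 2 = 0 ∧
          quadraticChar k (c * (d₀ * A * v.1 ^ 2 + d₂ * C * v.2.2 ^ 2)) = -1).card : ℤ) := by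
  rw [natCast_card_filter, natCast_card_filter, ← Finset.sum_sub_distrib]
  refine Finset.sum_congr rfl fun v _ => ?_
  by_cases h : d₀ * v.1 ^ 2 + d₁ * v.2.1 ^ 2 + d₂ * v.2.2 ^ 2 = 0
  · simp only [h, true_and, if_true]
    exact quadraticChar_eq_ite_sub_ite _
  · simp only [h, false_and, if_false, sub_zero]

/-- **The isotropic vectors partition by class: `#{iso} = #{class +} + #{class −} + #{iso ∧ Q = 0}`** (`c ≠ 0`: `χ(cQ) = 0 ⟺ Q = 0`).
[cite: Rogawski1990, §4.9 Prop. 4.9.1 (b) p. 55] -/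
theorem card_iso_eq_card_add_card_add_card (hc : c ≠ 0) :
    ((univ.filter fun v : k × k × k => d₀ * v.1 ^ 2 + d₁ * v.2.1 ^ 2 + d₂ * v.2.2 ^ 2 = 0).card : ℤ) =
      ((univ.filter fun v : k × k × k => d₀ * v.1 ^ 2 + d₁ * v.2.1 ^ 2 + d₂ * v.2.2 ^ 2 = 0 ∧
          quadraticChar k (c * (d₀ * A * v.1 ^ 2 + d₂ * C * v.2.2 ^ 2)) = 1).card : ℤ) +
      ((univ.filter fun v : k × k × k => d₀ * v.1 ^ 2 + d₁ * v.2.1 ^ 2 + d₂ * v.2.2 ^ 2 = 0 ∧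
          quadraticChar k (c * (d₀ * A * v.1 ^ 2 + d₂ * C * v.2.2 ^ 2)) = -1).card : ℤ) +
      ((univ.filter fun v : k × k × k => d₀ * v.1 ^ 2 + d₁ * v.2.1 ^ 2 + d₂ * v.2.2 ^ 2 = 0 ∧
          d₀ * A * v.1 ^ 2 + d₂ * C * v.2.2 ^ 2 = 0).card : ℤ) := by
  rw [natCast_card_filter, natCast_card_filter, natCast_card_filter, natCast_card_filter, ← Finset.sum_add_distrib, ← Finset.sum_add_distrib]
  refine Finset.sum_congr rfl fun v _ => ?_
  by_cases h : d₀ * v.1 ^ 2 + d₁ * v.2.1 ^ 2 + d₂ * v.2.2 ^ 2 = 0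
  · simp only [h, true_and, if_true]
    rcases eq_or_ne (d₀ * A * v.1 ^ 2 + d₂ * C * v.2.2 ^ 2) 0 with h0 | h0
    · rw [h0, mul_zero, MulChar.map_zero]; norm_num
    · have hne : c * (d₀ * A * v.1 ^ 2 + d₂ * C * v.2.2 ^ 2) ≠ 0 := mul_ne_zero hc h0
      rcases quadraticChar_dichotomy hne with h1 | h1 <;> rw [h1] <;> simp [h0]
  · simp only [h, false_and, if_false, add_zero]

/-- **`2·#{class σ}_d = q² − #{iso ∧ Q = 0}_d + σ·J_c(d)`** for `σ = ±1` (from the partition, `J = #{+} − #{−}`, `#{iso} = q²`).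
[cite: Rogawski1990, §4.9 Prop. 4.9.1 (b) p. 55] [cite: IrelandRosen1990, Ch. 8 §2] -/
theorem two_mul_card_rootClass_eq (hk : ringChar k ≠ 2) (hd₀ : d₀ ≠ 0) (hd₁ : d₁ ≠ 0) (hd₂ : d₂ ≠ 0) (hc : c ≠ 0) {σ : ℤ} (hσ : σ = 1 ∨ σ = -1) :
    2 * ((univ.filter fun v : k × k × k => d₀ * v.1 ^ 2 + d₁ * v.2.1 ^ 2 + d₂ * v.2.2 ^ 2 = 0 ∧
          quadraticChar k (c * (d₀ * A * v.1 ^ 2 + d₂ * C * v.2.2 ^ 2)) = σ).card : ℤ) =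
      (Fintype.card k : ℤ) ^ 2 -
        ((univ.filter fun v : k × k × k => d₀ * v.1 ^ 2 + d₁ * v.2.1 ^ 2 + d₂ * v.2.2 ^ 2 = 0 ∧
          d₀ * A * v.1 ^ 2 + d₂ * C * v.2.2 ^ 2 = 0).card : ℤ) +
        σ * ∑ v : k × k × k, if d₀ * v.1 ^ 2 + d₁ * v.2.1 ^ 2 + d₂ * v.2.2 ^ 2 = 0 then
          quadraticChar k (c * (d₀ * A * v.1 ^ 2 + d₂ * C * v.2.2 ^ 2)) else 0 := by
  have hP := card_iso_eq_card_add_card_add_card (d₀ := d₀) (d₁ := d₁) (d₂ := d₂) (A := A) (C := C) hc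
  rw [card_iso_eq_sq hk hd₀ hd₁ hd₂] at hP
  have hJ := rootClassSum_eq_card_sub_card (k := k) (d₀ := d₀) (d₁ := d₁) (d₂ := d₂) (A := A) (C := C) (c := c)
  rcases hσ with rfl | rfl
  · rw [one_mul, hJ]
    linear_combination (-1 : ℤ) * hP
  · rw [neg_one_mul, hJ]
    linear_combination (-1 : ℤ) * hP

end Counts

/-! ## §3 The κ-signed class counts over the four literals -/

section ClassTwists

variable {u₀ u₁ u₂ ε A C c : k}

/-- **THE κ-SIGNED ROOT CLASS COUNT: `Σ_b κ_b·#{v ∈ k³ : iso_b(v) ∧ χ(c·Q_b(v)) = σ} = −2(q−1)·χ(−u₀u₂AC)` for BOTH `σ = 1` and `σ = −1`** (every `c ≠ 0`;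
twists `(ε^{b_α}u₀, ε^{b_u}u₁, ε^{b_α+b_u}u₂)`, `κ_b = (−1)^{b_u}`).  The κ-signed non-null top layer `−4(q−1)χ(−u₀u₂AC)` (★ `signedSum_card_rootNull_twists`, vector currency)
splits EVENLY between the two square classes because the class difference `J` is twist-invariant (`signedSum_rootClassSum_twists`); in LINE currency (÷ `(q − 1)`):
`Σ_b κ_b·#{lines of class σ}_b = −2χ(−u₀u₂AC)` — the `1⁺` and `1⁻` slots of the certificate are equal. [cite: Rogawski1990, §4.9 Prop. 4.9.1 (b) p. 55; §12.2] [cite: LabesseLanglands1979, §5] -/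
theorem signedSum_card_rootClass_twists (hk : ringChar k ≠ 2) (hε : quadraticChar k ε = -1) (hu₀ : u₀ ≠ 0) (hu₁ : u₁ ≠ 0) (hu₂ : u₂ ≠ 0)
    (hA : A ≠ 0) (hC : C ≠ 0) (hAC : A ≠ C) (hc : c ≠ 0) {σ : ℤ} (hσ : σ = 1 ∨ σ = -1) :
    (∑ b : Fin 2 × Fin 2, (-1 : ℤ) ^ (b.2 : ℕ) *
      ((univ.filter fun v : k × k × k =>
          ε ^ (b.1 : ℕ) * u₀ * v.1 ^ 2 + ε ^ (b.2 : ℕ) * u₁ * v.2.1 ^ 2 + ε ^ ((b.1 : ℕ) + b.2) * u₂ * v.2.2 ^ 2 = 0 ∧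
          quadraticChar k (c * (ε ^ (b.1 : ℕ) * u₀ * A * v.1 ^ 2 + ε ^ ((b.1 : ℕ) + b.2) * u₂ * C * v.2.2 ^ 2)) = σ).card : ℤ)) =
      -2 * ((Fintype.card k : ℤ) - 1) * quadraticChar k (-(u₀ * u₂ * A * C)) := by
  have hε0 : ε ≠ 0 := by
    rintro rfl
    rw [MulChar.map_zero] at hε
    norm_num at hε
  have hne : ∀ n : ℕ, ∀ {u : k}, u ≠ 0 → ε ^ n * u ≠ 0 := fun n u hu => mul_ne_zero (pow_ne_zero _ hε0) hu
  -- multiply by `2` and use the per-literal identity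
  have h2 : 2 * (∑ b : Fin 2 × Fin 2, (-1 : ℤ) ^ (b.2 : ℕ) *
      ((univ.filter fun v : k × k × k =>
          ε ^ (b.1 : ℕ) * u₀ * v.1 ^ 2 + ε ^ (b.2 : ℕ) * u₁ * v.2.1 ^ 2 + ε ^ ((b.1 : ℕ) + b.2) * u₂ * v.2.2 ^ 2 = 0 ∧
          quadraticChar k (c * (ε ^ (b.1 : ℕ) * u₀ * A * v.1 ^ 2 + ε ^ ((b.1 : ℕ) + b.2) * u₂ * C * v.2.2 ^ 2)) = σ).card : ℤ)) =
      ∑ b : Fin 2 × Fin 2, (-1 : ℤ) ^ (b.2 : ℕ) *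
        ((Fintype.card k : ℤ) ^ 2 -
          (1 + ((Fintype.card k : ℤ) - 1) *
            ((univ.filter fun p : k × k =>
              ε ^ (b.1 : ℕ) * u₀ + ε ^ (b.2 : ℕ) * u₁ * p.1 ^ 2 + ε ^ ((b.1 : ℕ) + b.2) * u₂ * p.2 ^ 2 = 0 ∧
              ε ^ (b.1 : ℕ) * u₀ * A + ε ^ ((b.1 : ℕ) + b.2) * u₂ * C * p.2 ^ 2 = 0).card : ℤ)) +
          σ * ∑ v : k × k × k, if ε ^ (b.1 : ℕ) * u₀ * v.1 ^ 2 + ε ^ (b.2 : ℕ) * u₁ * v.2.1 ^ 2 + ε ^ ((b.1 : ℕ) + b.2) * u₂ * v.2.2 ^ 2 = 0 then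
            quadraticChar k (c * (ε ^ (b.1 : ℕ) * u₀ * A * v.1 ^ 2 + ε ^ ((b.1 : ℕ) + b.2) * u₂ * C * v.2.2 ^ 2)) else 0) := by
    rw [Finset.mul_sum]
    refine Finset.sum_congr rfl fun b _ => ?_
    rw [mul_left_comm, two_mul_card_rootClass_eq hk (hne _ hu₀) (hne _ hu₁) (hne _ hu₂) hc hσ,
      card_isoNull_eq hk (hne _ hu₁) (hne _ hu₂) hC]
  have hJ := signedSum_rootClassSum_twists hk hε hu₀ hu₁ hu₂ hA hC hAC hc
  have hN := signedSum_card_rootNull_twists (u₀ := u₀) (A := A) hk hε hu₁ hu₂ hC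
  -- distribute the signed sum
  have hsplit : ∑ b : Fin 2 × Fin 2, (-1 : ℤ) ^ (b.2 : ℕ) *
        ((Fintype.card k : ℤ) ^ 2 -
          (1 + ((Fintype.card k : ℤ) - 1) *
            ((univ.filter fun p : k × k =>
              ε ^ (b.1 : ℕ) * u₀ + ε ^ (b.2 : ℕ) * u₁ * p.1 ^ 2 + ε ^ ((b.1 : ℕ) + b.2) * u₂ * p.2 ^ 2 = 0 ∧
              ε ^ (b.1 : ℕ) * u₀ * A + ε ^ ((b.1 : ℕ) + b.2) * u₂ * C * p.2 ^ 2 = 0).card : ℤ)) +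
          σ * ∑ v : k × k × k, if ε ^ (b.1 : ℕ) * u₀ * v.1 ^ 2 + ε ^ (b.2 : ℕ) * u₁ * v.2.1 ^ 2 + ε ^ ((b.1 : ℕ) + b.2) * u₂ * v.2.2 ^ 2 = 0 then
            quadraticChar k (c * (ε ^ (b.1 : ℕ) * u₀ * A * v.1 ^ 2 + ε ^ ((b.1 : ℕ) + b.2) * u₂ * C * v.2.2 ^ 2)) else 0) =
      (∑ b : Fin 2 × Fin 2, (-1 : ℤ) ^ (b.2 : ℕ) * ((Fintype.card k : ℤ) ^ 2 - 1)) -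
        ((Fintype.card k : ℤ) - 1) * (∑ b : Fin 2 × Fin 2, (-1 : ℤ) ^ (b.2 : ℕ) *
            ((univ.filter fun p : k × k =>
              ε ^ (b.1 : ℕ) * u₀ + ε ^ (b.2 : ℕ) * u₁ * p.1 ^ 2 + ε ^ ((b.1 : ℕ) + b.2) * u₂ * p.2 ^ 2 = 0 ∧
              ε ^ (b.1 : ℕ) * u₀ * A + ε ^ ((b.1 : ℕ) + b.2) * u₂ * C * p.2 ^ 2 = 0).card : ℤ)) +
        σ * (∑ b : Fin 2 × Fin 2, (-1 : ℤ) ^ (b.2 : ℕ) *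
          ∑ v : k × k × k, if ε ^ (b.1 : ℕ) * u₀ * v.1 ^ 2 + ε ^ (b.2 : ℕ) * u₁ * v.2.1 ^ 2 + ε ^ ((b.1 : ℕ) + b.2) * u₂ * v.2.2 ^ 2 = 0 then
            quadraticChar k (c * (ε ^ (b.1 : ℕ) * u₀ * A * v.1 ^ 2 + ε ^ ((b.1 : ℕ) + b.2) * u₂ * C * v.2.2 ^ 2)) else 0) := by
    rw [Finset.mul_sum, Finset.mul_sum, ← Finset.sum_sub_distrib, ← Finset.sum_add_distrib]
    refine Finset.sum_congr rfl fun b _ => ?_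
    ring
  have hconst : ∑ b : Fin 2 × Fin 2, (-1 : ℤ) ^ (b.2 : ℕ) * ((Fintype.card k : ℤ) ^ 2 - 1) = 0 := by
    simp only [Fintype.sum_prod_type, Fin.sum_univ_two, Fin.val_zero, Fin.val_one, pow_zero, pow_one]
    ring
  rw [hsplit, hconst, hN, hJ] at h2
  rcases hσ with rfl | rfl <;> linarith

/-- **THE UNSIGNED ROOT CLASS COUNT through `J`: `2·Σ_b #{v : iso_b ∧ χ(cQ_b) = σ} = 4q(q−1) + 4σ·J_c(u)`** (★ `sum_card_rootNull_twists`: `Σ_b #null_b = 4`; `J_c(u)` the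
twist-invariant class sum, not evaluated here). [cite: Rogawski1990, §4.9 Prop. 4.9.1 (b) p. 55] [cite: LabesseLanglands1979, §5] -/
theorem two_mul_sum_card_rootClass_twists (hk : ringChar k ≠ 2) (hε : quadraticChar k ε = -1) (hu₀ : u₀ ≠ 0) (hu₁ : u₁ ≠ 0) (hu₂ : u₂ ≠ 0)
    (hA : A ≠ 0) (hC : C ≠ 0) (hAC : A ≠ C) (hc : c ≠ 0) {σ : ℤ} (hσ : σ = 1 ∨ σ = -1) :
    2 * (∑ b : Fin 2 × Fin 2,
      ((univ.filter fun v : k × k × k =>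
          ε ^ (b.1 : ℕ) * u₀ * v.1 ^ 2 + ε ^ (b.2 : ℕ) * u₁ * v.2.1 ^ 2 + ε ^ ((b.1 : ℕ) + b.2) * u₂ * v.2.2 ^ 2 = 0 ∧
          quadraticChar k (c * (ε ^ (b.1 : ℕ) * u₀ * A * v.1 ^ 2 + ε ^ ((b.1 : ℕ) + b.2) * u₂ * C * v.2.2 ^ 2)) = σ).card : ℤ)) =
      4 * (Fintype.card k : ℤ) * ((Fintype.card k : ℤ) - 1) +
        4 * σ * ∑ v : k × k × k, if u₀ * v.1 ^ 2 + u₁ * v.2.1 ^ 2 + u₂ * v.2.2 ^ 2 = 0 then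
          quadraticChar k (c * (u₀ * A * v.1 ^ 2 + u₂ * C * v.2.2 ^ 2)) else 0 := by
  have hε0 : ε ≠ 0 := by
    rintro rfl
    rw [MulChar.map_zero] at hε
    norm_num at hε
  have hne : ∀ n : ℕ, ∀ {u : k}, u ≠ 0 → ε ^ n * u ≠ 0 := fun n u hu => mul_ne_zero (pow_ne_zero _ hε0) hu
  rw [Finset.mul_sum]
  have hb : ∀ b : Fin 2 × Fin 2, 2 * ((univ.filter fun v : k × k × k =>
          ε ^ (b.1 : ℕ) * u₀ * v.1 ^ 2 + ε ^ (b.2 : ℕ) * u₁ * v.2.1 ^ 2 + ε ^ ((b.1 : ℕ) + b.2) * u₂ * v.2.2 ^ 2 = 0 ∧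
          quadraticChar k (c * (ε ^ (b.1 : ℕ) * u₀ * A * v.1 ^ 2 + ε ^ ((b.1 : ℕ) + b.2) * u₂ * C * v.2.2 ^ 2)) = σ).card : ℤ) =
      (Fintype.card k : ℤ) ^ 2 -
          (1 + ((Fintype.card k : ℤ) - 1) *
            ((univ.filter fun p : k × k =>
              ε ^ (b.1 : ℕ) * u₀ + ε ^ (b.2 : ℕ) * u₁ * p.1 ^ 2 + ε ^ ((b.1 : ℕ) + b.2) * u₂ * p.2 ^ 2 = 0 ∧
              ε ^ (b.1 : ℕ) * u₀ * A + ε ^ ((b.1 : ℕ) + b.2) * u₂ * C * p.2 ^ 2 = 0).card : ℤ)) +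
          σ * ∑ v : k × k × k, if u₀ * v.1 ^ 2 + u₁ * v.2.1 ^ 2 + u₂ * v.2.2 ^ 2 = 0 then
            quadraticChar k (c * (u₀ * A * v.1 ^ 2 + u₂ * C * v.2.2 ^ 2)) else 0 := by
    intro b
    rw [two_mul_card_rootClass_eq hk (hne _ hu₀) (hne _ hu₁) (hne _ hu₂) hc hσ, card_isoNull_eq hk (hne _ hu₁) (hne _ hu₂) hC,
      rootClassSum_twist hk hε hu₀ hu₁ hu₂ hA hC hAC hc]
  simp_rw [hb]
  have hN := sum_card_rootNull_twists (u₀ := u₀) (A := A) hk hε hu₁ hu₂ hC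
  simp only [Fintype.sum_prod_type, Fin.sum_univ_two, Fin.val_zero, Fin.val_one] at hN ⊢
  linear_combination (-((Fintype.card k : ℤ) - 1)) * hN

end ClassTwists

end Literature.NumberTheory.Rogawski1990
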